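import Summits.HubbardSuperconductivity.HubbardSuperconductivity.Theses.SeamInduction
import Literature.MathematicalPhysics.QuantumLattice.MagneticHubbardTorusGauge

/-!
# Crux `PerWidthThermodynamics` (item `stmt-HubbardSuperconductivity-18510`, route SeamInduction):
# the crux's functionals named, and the two-column gauge (`L = 2` is twist-blind)

Negative-side lemmas of the standing disprover (cdisprove cycle 1). The crux
`Theses.SeamInduction.PerWidthThermodynamics` is `∃ U > 0, ∃ δ ∈ (0,3/10), ∀ even M ≥ 2, ∃ d_M > 0,
k_M, L_M, ∀ even L ≥ max(M, L_M), ∀ carriers e : Λ ≃ ℤ/L × ℤ/M: d_M ≤ stiff ∧ 0 < icomp ≤ k_M`, over a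
`let`-prefix of six functionals. Here:

* the six functionals are NAMED (`tubeH0`, `seamTw`, `sectorE`, `Np`, `stiff`, `icomp`) and
  `perWidthThermodynamics_iff` certifies by `Iff.rfl` that the crux is literally the statement over
  them (so every lemma below is about the crux's own functionals);
* `seamTw_two_gauge`, `sectorE_two`, `stiff_two_eq_zero` — on the two-column tube `L = 2` the seam
  twist `(1 - e^{iθ}) c†_{(0,b)} c_{(-1,b)} + h.c.` is a PURE GAUGE: the nearest-neighbour
  `SimpleGraph.fromRel` graph of `ℤ/2 × ℤ/M` has one bond between the two columns in each row, and
  conjugation by the tree's site-phase unitary `phaseGauge` (phase `e^{iθ}` on column `1 = -1`)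
  removes the Peierls factor (`Matrix.minEnergyOn` is invariant, `minEnergyOn_szSector_phaseGauge_conj`);
  hence the crux's stiffness functional vanishes identically at `L = 2`, for every `U, δ, M, Λ, e`;
* consequence (companion file `PerWidthThermodynamicsFalseWithoutL1.lean`): the crux with the
  cut-off `L₁` deleted is FALSE — `L₁ ≤ L` is load-bearing, any proof must use `L₁ ≥ 4`.

Koma–Tasaki, PRL 68 (1992) 3248, eqs. (5)–(8) (site gauge transformations); Lieb, PRL 73 (1994)
2158 (the spectrum depends on the phases only through the fluxes — and the two-column "tube" has no
flux through its long cycle). Workfile with the full attack log (incl. the `U = 0` parity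
obstruction and the numerics): `Cruxes/PerWidthThermodynamics/Disproof.lean`.
-/

set_option linter.dupNamespace false

noncomputable section

namespace Summit.HubbardSuperconductivity.HubbardSuperconductivity.Theorems.PerWidthThermodynamics.Negative

open Matrix Finset Literature.MathematicalPhysics.QuantumLattice
open scoped ComplexConjugate BigOperators

/-! ### The functionals of the crux, named -/

section Functionals

open scoped Classical in
/-- The pure Hubbard tube Hamiltonian on the carrier `Λ ≃ ℤ/L × ℤ/M` (the `H0` let of the crux):
nearest-neighbour `SimpleGraph.fromRel` graph, `t = 1`. -/
def tubeH0 (L M : ℕ) (Λ : Type) [LinearOrder Λ] [Fintype Λ] (e : Λ ≃ ZMod L × ZMod M) (U : ℝ) :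
    Matrix (Finset (Orb Λ)) (Finset (Orb Λ)) ℂ :=
  hamiltonian (SimpleGraph.fromRel fun x y : Λ =>
    y = e.symm ((e x).1 + 1, (e x).2) ∨ y = e.symm ((e x).1, (e x).2 + 1)) 1 U

/-- The seam twist (the `Tw` let of the crux): Peierls phase `e^{±iθ}` on the bonds between the
columns `-1` and `0`, written as an additive correction to `tubeH0`. -/
def seamTw (L M : ℕ) [NeZero L] [NeZero M] (Λ : Type) [LinearOrder Λ] [Fintype Λ]
    (e : Λ ≃ ZMod L × ZMod M) (θ : ℝ) : Matrix (Finset (Orb Λ)) (Finset (Orb Λ)) ℂ :=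
  ∑ b : ZMod M, ∑ σ : Fin 2,
    ((1 - Complex.exp (Complex.I * θ)) •
        (creation (orb (e.symm (0, b)) σ) * annihilation (orb (e.symm (-1, b)) σ)) +
      (1 - Complex.exp (-(Complex.I * θ))) •
        (creation (orb (e.symm (-1, b)) σ) * annihilation (orb (e.symm (0, b)) σ)))

/-- Sector ground energy of the twisted tube in `(N, S^z = 0)` (the `E` let of the crux). -/
def sectorE (L M : ℕ) [NeZero L] [NeZero M] (Λ : Type) [LinearOrder Λ] [Fintype Λ]
    (e : Λ ≃ ZMod L × ZMod M) (U θ : ℝ) (N : ℕ) : ℝ :=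
  (tubeH0 L M Λ e U + seamTw L M Λ e θ).minEnergyOn (szSector N 0)

/-- The particle number `N_{L,M} = 2⌊(1-δ)LM/2⌋` (the `Np` let of the crux). -/
def Np (L M : ℕ) (δ : ℝ) : ℕ := 2 * ⌊(1 - δ) * ((L : ℝ) * (M : ℝ)) / 2⌋₊

/-- Twist stiffness per site read on the `θ₀ = π/3` envelope (the `stiff` let of the crux). -/
def stiff (L M : ℕ) [NeZero L] [NeZero M] (Λ : Type) [LinearOrder Λ] [Fintype Λ]
    (e : Λ ≃ ZMod L × ZMod M) (U δ : ℝ) : ℝ :=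
  2 * (L : ℝ) * (sectorE L M Λ e U (Real.pi / 3) (Np L M δ) - sectorE L M Λ e U 0 (Np L M δ)) /
    ((Real.pi / 3) ^ 2 * (M : ℝ))

/-- Inverse pair compressibility `LM Δ²_N E / 4` (the `icomp` let of the crux). -/
def icomp (L M : ℕ) [NeZero L] [NeZero M] (Λ : Type) [LinearOrder Λ] [Fintype Λ]
    (e : Λ ≃ ZMod L × ZMod M) (U δ : ℝ) : ℝ :=
  (L : ℝ) * (M : ℝ) * (sectorE L M Λ e U 0 (Np L M δ + 2) + sectorE L M Λ e U 0 (Np L M δ - 2) -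
    2 * sectorE L M Λ e U 0 (Np L M δ)) / 4

/-- The crux unfolded: `PerWidthThermodynamics` IS the statement below over the named functionals
(definitional, `Iff.rfl`). -/
theorem perWidthThermodynamics_iff :
    Theses.SeamInduction.PerWidthThermodynamics ↔
      ∃ U : ℝ, 0 < U ∧ ∃ δ ∈ Set.Ioo (0 : ℝ) (3 / 10), ∀ (M : ℕ) [NeZero M], Even M → 2 ≤ M →
        ∃ d : ℝ, 0 < d ∧ ∃ k : ℝ, ∃ L₁ : ℕ, ∀ (L : ℕ) [NeZero L], Even L → M ≤ L → L₁ ≤ L →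
          ∀ (Λ : Type) [LinearOrder Λ] [Fintype Λ] (e : Λ ≃ ZMod L × ZMod M),
            d ≤ stiff L M Λ e U δ ∧ 0 < icomp L M Λ e U δ ∧ icomp L M Λ e U δ ≤ k :=
  Iff.rfl

end Functionals

/-! ### `L₁ ≤ L` IS load-bearing: on the two-column tube the seam twist is a pure gauge -/

section TwoColumns

/-- `-1 = 1` in `ℤ/2` (the seam column `-1` is column `1`). -/
theorem zmod_two_neg_one : (-1 : ZMod 2) = 1 := by decide

/-- `a + 1 ≠ a` in `ℤ/2` (the two columns are distinct). -/
theorem zmod_two_add_one_ne (a : ZMod 2) : a + 1 ≠ a := by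
  revert a; decide

/-- `b + 1 = a → b = a + 1` in `ℤ/2`. -/
theorem zmod_two_eq_add_one_of_add_one_eq {a b : ZMod 2} (h : b + 1 = a) : b = a + 1 := by
  revert a b; decide

/-- `a + 1 = 0 ↔ a ≠ 0` in `ℤ/2`. -/
theorem zmod_two_add_one_eq_zero_iff (a : ZMod 2) : a + 1 = 0 ↔ a ≠ 0 := by
  revert a; decide

/-- Sums over `ℤ/2` have two terms. -/
theorem sum_zmod_two {β : Type*} [AddCommMonoid β] (f : ZMod 2 → β) :
    ∑ a : ZMod 2, f a = f 0 + f 1 :=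
  Fin.sum_univ_two f

/-- The circle exponential as a complex exponential, in the crux's normal form `exp (I θ)`. -/
theorem coe_circleExp (θ : ℝ) : ((Circle.exp θ : Circle) : ℂ) = Complex.exp (Complex.I * θ) := by
  rw [Circle.coe_exp, mul_comm]

/-- Its conjugate, in the crux's normal form `exp (-(I θ))`. -/
theorem conj_coe_circleExp (θ : ℝ) :
    conj ((Circle.exp θ : Circle) : ℂ) = Complex.exp (-(Complex.I * θ)) := by
  rw [← Circle.coe_inv_eq_conj, ← Circle.exp_neg, coe_circleExp]
  push_cast
  ring_nf

variable {M : ℕ} {Λ : Type}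

/-- The column gauge of the two-column tube: phase `e^{iθ}` on column `1 = -1`, phase `1` on
column `0`. -/
def colGauge (e : Λ ≃ ZMod 2 × ZMod M) (θ : ℝ) : Λ → Circle :=
  fun x => if (e x).1 = 0 then 1 else Circle.exp θ

/-- The right neighbour `x⁺ = e⁻¹((e x).1 + 1, (e x).2)` (other column, same row). -/
def colShift (e : Λ ≃ ZMod 2 × ZMod M) (x : Λ) : Λ := e.symm ((e x).1 + 1, (e x).2)

/-- Coordinates of `x⁺`. -/
theorem apply_colShift (e : Λ ≃ ZMod 2 × ZMod M) (x : Λ) :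
    e (colShift e x) = ((e x).1 + 1, (e x).2) := by
  simp [colShift]

/-- `x⁺ ≠ x`. -/
theorem colShift_ne (e : Λ ≃ ZMod 2 × ZMod M) (x : Λ) : colShift e x ≠ x := by
  intro h
  have h1 := congrArg (fun z => (e z).1) h
  simp only [apply_colShift] at h1
  exact zmod_two_add_one_ne _ h1

open scoped Classical in
/-- Adjacency of the two-column tube graph, sorted by columns: a neighbour of `x` is either
`x⁺` (the other column, same row) or lies in the same column. -/
theorem adj_cases (e : Λ ≃ ZMod 2 × ZMod M) {x y : Λ}
    (h : (SimpleGraph.fromRel fun x y : Λ =>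
      y = e.symm ((e x).1 + 1, (e x).2) ∨ y = e.symm ((e x).1, (e x).2 + 1)).Adj x y) :
    y = colShift e x ∨ (y ≠ colShift e x ∧ (e y).1 = (e x).1) := by
  by_cases hy : y = colShift e x
  · exact Or.inl hy
  · refine Or.inr ⟨hy, ?_⟩
    rw [SimpleGraph.fromRel_adj] at h
    obtain ⟨-, (h1 | h1) | (h1 | h1)⟩ := h
    · exact absurd h1 hy
    · have h2 : (e y).1 = (e x).1 := by
        have := congrArg (fun z => (e z).1) h1; simpa using this
      exact h2
    · -- `x = y⁺`, so `y = x⁺` in `ℤ/2`: contradiction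
      exfalso; apply hy
      have h2 := congrArg e h1
      simp only [Equiv.apply_symm_apply] at h2
      apply e.injective
      rw [apply_colShift, Prod.ext_iff]
      refine ⟨?_, ?_⟩
      · have := congrArg Prod.fst h2; simp only at this
        exact zmod_two_eq_add_one_of_add_one_eq this.symm
      · have := congrArg Prod.snd h2; simp only at this
        exact this.symm
    · have h2 : (e x).1 = (e y).1 := by
        have := congrArg (fun z => (e z).1) h1; simpa using this
      exact h2.symm

open scoped Classical in
/-- `x⁺` is adjacent to `x`. -/
theorem adj_colShift (e : Λ ≃ ZMod 2 × ZMod M) (x : Λ) :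
    (SimpleGraph.fromRel fun x y : Λ =>
      y = e.symm ((e x).1 + 1, (e x).2) ∨ y = e.symm ((e x).1, (e x).2 + 1)).Adj x (colShift e x) := by
  rw [SimpleGraph.fromRel_adj]
  exact ⟨(colShift_ne e x).symm, Or.inl (Or.inl rfl)⟩

/-- The bond phase of the column gauge: `1` inside a column, `φ x` across. -/
def crossPhase (e : Λ ≃ ZMod 2 × ZMod M) (θ : ℝ) (x : Λ) : ℂ :=
  if (e x).1 = 0 then conj ((Circle.exp θ : Circle) : ℂ) else ((Circle.exp θ : Circle) : ℂ)

/-- Inside a column the gauge phases cancel. -/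
theorem gauge_product_same (e : Λ ≃ ZMod 2 × ZMod M) (θ : ℝ) {x y : Λ} (h : (e y).1 = (e x).1) :
    (colGauge e θ x : ℂ) * conj (colGauge e θ y : ℂ) = 1 := by
  unfold colGauge
  rw [h]
  split_ifs
  · simp
  · rw [Complex.mul_conj, Circle.normSq_coe, Complex.ofReal_one]

/-- Across the columns the gauge phases give `φ x`. -/
theorem gauge_product_shift (e : Λ ≃ ZMod 2 × ZMod M) (θ : ℝ) (x : Λ) :
    (colGauge e θ x : ℂ) * conj (colGauge e θ (colShift e x) : ℂ) = crossPhase e θ x := by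
  unfold colGauge crossPhase
  rw [apply_colShift]
  by_cases hx : (e x).1 = 0
  · have h1 : (e x).1 + 1 ≠ 0 := by rw [hx]; decide
    rw [if_pos hx, if_neg h1, if_pos hx, Circle.coe_one, one_mul]
  · have h1 : (e x).1 + 1 = 0 := (zmod_two_add_one_eq_zero_iff _).2 hx
    rw [if_neg hx, if_pos h1, if_neg hx, Circle.coe_one, map_one, mul_one]

variable [LinearOrder Λ] [Fintype Λ]

/-- Pointwise form of the gauged hopping row of `x`: the plain row plus the single cross term. -/
theorem gauged_row (e : Λ ≃ ZMod 2 × ZMod M) (θ : ℝ) (x : Λ) (σ : Fin 2)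
    (A : Λ → Λ → Prop) [DecidableRel A]
    (hA : ∀ y, A x y → y = colShift e x ∨ (y ≠ colShift e x ∧ (e y).1 = (e x).1))
    (hA' : A x (colShift e x)) :
    (∑ y : Λ, if A x y then ((colGauge e θ x : ℂ) * conj (colGauge e θ y : ℂ)) •
        (creation (orb x σ) * annihilation (orb y σ)) else 0) =
      (∑ y : Λ, if A x y then creation (orb x σ) * annihilation (orb y σ) else 0) +
        (crossPhase e θ x - 1) • (creation (orb x σ) * annihilation (orb (colShift e x) σ)) := by
  have key : ∀ y : Λ, (if A x y then ((colGauge e θ x : ℂ) * conj (colGauge e θ y : ℂ)) •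
        (creation (orb x σ) * annihilation (orb y σ)) else 0) =
      (if A x y then creation (orb x σ) * annihilation (orb y σ) else 0) +
        (if y = colShift e x then
          (crossPhase e θ x - 1) • (creation (orb x σ) * annihilation (orb y σ)) else 0) := by
    intro y
    by_cases hxy : A x y
    · rw [if_pos hxy, if_pos hxy]
      rcases hA y hxy with rfl | ⟨hne, hcol⟩
      · rw [if_pos rfl, gauge_product_shift, sub_smul, one_smul, add_sub_cancel]
      · rw [if_neg hne, gauge_product_same e θ hcol, one_smul, add_zero]
    · have hne : y ≠ colShift e x := fun h => hxy (h ▸ hA')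
      rw [if_neg hxy, if_neg hxy, if_neg hne, add_zero]
  simp only [key, Finset.sum_add_distrib, Finset.sum_ite_eq', Finset.mem_univ, if_true]

/-- **Gauge conjugation of a two-column Hubbard Hamiltonian** (any graph whose neighbours of `x`
are `x⁺` and same-column sites): `W H Wᴴ = H − Σ_x Σ_σ (φ_x − 1) c†_x c_{x⁺}`. -/
theorem gauge_hamiltonian_two (G : SimpleGraph Λ) [DecidableRel G.Adj] (e : Λ ≃ ZMod 2 × ZMod M)
    (U θ : ℝ) (hA : ∀ x y, G.Adj x y → y = colShift e x ∨ (y ≠ colShift e x ∧ (e y).1 = (e x).1))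
    (hA' : ∀ x, G.Adj x (colShift e x)) :
    phaseGauge (colGauge e θ) * hamiltonian G 1 U * (phaseGauge (colGauge e θ))ᴴ =
      hamiltonian G 1 U -
        ∑ x : Λ, ∑ σ : Fin 2, (crossPhase e θ x - 1) •
          (creation (orb x σ) * annihilation (orb (colShift e x) σ)) := by
  set W := phaseGauge (colGauge e θ) with hW
  have hnum : ∀ x : Λ, W * (numberOp x 0 * numberOp x 1) * Wᴴ = numberOp x 0 * numberOp x 1 := by
    intro x
    rw [hW, phaseGauge_mul_mul_mul_conjTranspose, phaseGauge_mul_numberOp_mul_conjTranspose,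
      phaseGauge_mul_numberOp_mul_conjTranspose]
  have hhop : ∀ (x y : Λ) (σ : Fin 2),
      W * (if G.Adj x y then creation (orb x σ) * annihilation (orb y σ) else 0) * Wᴴ =
        (if G.Adj x y then ((colGauge e θ x : ℂ) * conj (colGauge e θ y : ℂ)) •
          (creation (orb x σ) * annihilation (orb y σ)) else 0) := by
    intro x y σ
    split_ifs
    · rw [hW, phaseGauge_mul_mul_mul_conjTranspose, phaseGauge_mul_creation_mul_conjTranspose,
        phaseGauge_mul_annihilation_mul_conjTranspose, smul_mul_smul_comm]
    · rw [Matrix.mul_zero, Matrix.zero_mul]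
  have hswap : ∀ x : Λ, (∑ y : Λ, ∑ σ : Fin 2,
      if G.Adj x y then ((colGauge e θ x : ℂ) * conj (colGauge e θ y : ℂ)) •
        (creation (orb x σ) * annihilation (orb y σ)) else 0) =
      (∑ y : Λ, ∑ σ : Fin 2, if G.Adj x y then creation (orb x σ) * annihilation (orb y σ) else 0) +
        ∑ σ : Fin 2, (crossPhase e θ x - 1) •
          (creation (orb x σ) * annihilation (orb (colShift e x) σ)) := by
    intro x
    rw [Finset.sum_comm, Finset.sum_comm (f := fun y σ => if G.Adj x y then
      creation (orb x σ) * annihilation (orb y σ) else 0), ← Finset.sum_add_distrib]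
    exact Finset.sum_congr rfl fun σ _ => gauged_row e θ x σ G.Adj (hA x) (hA' x)
  unfold hamiltonian
  simp only [Matrix.mul_add, Matrix.add_mul, Matrix.mul_smul, Matrix.smul_mul, Finset.mul_sum,
    Finset.sum_mul, hnum, hhop]
  simp only [hswap, Finset.sum_add_distrib, smul_add, Complex.ofReal_one, neg_smul, one_smul]
  abel

/-- **Gauge conjugation of the pure two-column tube**: `W H0 Wᴴ = H0 − Σ_x Σ_σ (φ_x − 1) c†_x c_{x⁺}`. -/
theorem gauge_tubeH0_two (e : Λ ≃ ZMod 2 × ZMod M) (U θ : ℝ) :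
    phaseGauge (colGauge e θ) * tubeH0 2 M Λ e U * (phaseGauge (colGauge e θ))ᴴ =
      tubeH0 2 M Λ e U -
        ∑ x : Λ, ∑ σ : Fin 2, (crossPhase e θ x - 1) •
          (creation (orb x σ) * annihilation (orb (colShift e x) σ)) := by
  unfold tubeH0
  exact gauge_hamiltonian_two _ e U θ (fun x y h => adj_cases e h) (adj_colShift e)

variable [NeZero M]

/-- **Gauge conjugation of the seam twist** on two columns: the phases `e^{∓iθ}` appear on the
two cross terms. -/
theorem gauge_seamTw_two (e : Λ ≃ ZMod 2 × ZMod M) (θ : ℝ) :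
    phaseGauge (colGauge e θ) * seamTw 2 M Λ e θ * (phaseGauge (colGauge e θ))ᴴ =
      ∑ b : ZMod M, ∑ σ : Fin 2,
        (((1 - Complex.exp (Complex.I * θ)) * conj ((Circle.exp θ : Circle) : ℂ)) •
            (creation (orb (e.symm (0, b)) σ) * annihilation (orb (e.symm (1, b)) σ)) +
          ((1 - Complex.exp (-(Complex.I * θ))) * ((Circle.exp θ : Circle) : ℂ)) •
            (creation (orb (e.symm (1, b)) σ) * annihilation (orb (e.symm (0, b)) σ))) := by
  have g0 : ∀ b : ZMod M, colGauge e θ (e.symm (0, b)) = 1 := fun b => by simp [colGauge]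
  have g1 : ∀ b : ZMod M, colGauge e θ (e.symm (1, b)) = Circle.exp θ := fun b => by
    simp [colGauge]
  unfold seamTw
  rw [zmod_two_neg_one]
  simp only [Finset.mul_sum, Finset.sum_mul, Matrix.mul_add, Matrix.add_mul, Matrix.mul_smul,
    Matrix.smul_mul, phaseGauge_mul_mul_mul_conjTranspose, phaseGauge_mul_creation_mul_conjTranspose,
    phaseGauge_mul_annihilation_mul_conjTranspose, smul_mul_smul_comm, smul_smul, g0, g1,
    Circle.coe_one, map_one, one_mul, mul_one]

/-- **The seam twist of the two-column tube is a pure gauge**: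
`W_θ (H0 + Tw θ) W_θᴴ = H0`. -/
theorem seamTw_two_gauge (e : Λ ≃ ZMod 2 × ZMod M) (U θ : ℝ) :
    phaseGauge (colGauge e θ) * (tubeH0 2 M Λ e U + seamTw 2 M Λ e θ) *
        (phaseGauge (colGauge e θ))ᴴ = tubeH0 2 M Λ e U := by
  rw [Matrix.mul_add, Matrix.add_mul, gauge_tubeH0_two, gauge_seamTw_two]
  -- reindex the correction sum over `Λ` by `(a, b) : ℤ/2 × ℤ/M` and split the two columns
  have hre : (∑ x : Λ, ∑ σ : Fin 2, (crossPhase e θ x - 1) •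
      (creation (orb x σ) * annihilation (orb (colShift e x) σ))) =
      ∑ b : ZMod M, ∑ σ : Fin 2,
        ((conj ((Circle.exp θ : Circle) : ℂ) - 1) •
            (creation (orb (e.symm (0, b)) σ) * annihilation (orb (e.symm (1, b)) σ)) +
          (((Circle.exp θ : Circle) : ℂ) - 1) •
            (creation (orb (e.symm (1, b)) σ) * annihilation (orb (e.symm (0, b)) σ))) := by
    rw [← Equiv.sum_comp e.symm, Fintype.sum_prod_type, sum_zmod_two, ← Finset.sum_add_distrib]
    refine Finset.sum_congr rfl fun b _ => ?_
    rw [← Finset.sum_add_distrib]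
    refine Finset.sum_congr rfl fun σ _ => ?_
    have c0 : crossPhase e θ (e.symm (0, b)) = conj ((Circle.exp θ : Circle) : ℂ) := by
      simp [crossPhase]
    have c1 : crossPhase e θ (e.symm (1, b)) = ((Circle.exp θ : Circle) : ℂ) := by
      simp [crossPhase]
    have s0 : colShift e (e.symm (0, b)) = e.symm (1, b) := by
      simp [colShift]
    have s1 : colShift e (e.symm (1, b)) = e.symm (0, b) := by
      simp only [colShift, Equiv.apply_symm_apply, show (1 : ZMod 2) + 1 = 0 from by decide]
    rw [c0, c1, s0, s1]
  rw [hre, sub_add_eq_add_sub, sub_eq_iff_eq_add, add_right_inj]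
  refine Finset.sum_congr rfl fun b _ => Finset.sum_congr rfl fun σ _ => ?_
  have e1 : (1 - Complex.exp (Complex.I * θ)) * conj ((Circle.exp θ : Circle) : ℂ) =
      conj ((Circle.exp θ : Circle) : ℂ) - 1 := by
    rw [← coe_circleExp, sub_mul, one_mul, Complex.mul_conj, Circle.normSq_coe, Complex.ofReal_one]
  have e2 : (1 - Complex.exp (-(Complex.I * θ))) * ((Circle.exp θ : Circle) : ℂ) =
      ((Circle.exp θ : Circle) : ℂ) - 1 := by
    rw [← conj_coe_circleExp, sub_mul, one_mul, mul_comm (conj _) _, Complex.mul_conj, Circle.normSq_coe,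
      Complex.ofReal_one]
  rw [e1, e2]

/-- At `θ = 0` the seam correction vanishes. -/
theorem seamTw_zero (L : ℕ) [NeZero L] (e : Λ ≃ ZMod L × ZMod M) : seamTw L M Λ e 0 = 0 := by
  unfold seamTw
  simp

/-- **`L = 2` is degenerate for the crux's stiffness functional**: the sector energies of the
two-column tube do not depend on the seam twist (pure gauge, `minEnergyOn` is invariant under the
sector-preserving unitary `phaseGauge`). -/
theorem sectorE_two (e : Λ ≃ ZMod 2 × ZMod M) (U θ : ℝ) (N : ℕ) :
    sectorE 2 M Λ e U θ N = sectorE 2 M Λ e U 0 N := by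
  unfold sectorE
  rw [seamTw_zero, add_zero]
  have h := minEnergyOn_szSector_phaseGauge_conj (colGauge e θ)⁻¹
    (tubeH0 2 M Λ e U + seamTw 2 M Λ e θ) N 0
  rw [phaseGauge_conjTranspose, inv_inv] at h
  rw [← h]
  congr 1
  have h2 := seamTw_two_gauge e U θ
  rw [phaseGauge_conjTranspose] at h2
  exact h2

/-- Hence the stiffness functional of the crux VANISHES identically at `L = 2`. -/
theorem stiff_two_eq_zero (e : Λ ≃ ZMod 2 × ZMod M) (U δ : ℝ) : stiff 2 M Λ e U δ = 0 := by
  unfold stiff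
  rw [sectorE_two, sub_self, mul_zero, zero_div]

end TwoColumns

end Summit.HubbardSuperconductivity.HubbardSuperconductivity.Theorems.PerWidthThermodynamics.Negative
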